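import Mathlib
import Summits.Ventures.PercRepro2.K5TypedSimple
import Summits.Ventures.PercRepro2.K5TypedK3Marks

/-!
# ROW 2′TRI ON EVERY SIMPLE GRAPH ON FIVE MARKED VERTICES, ALL MINORS
(blind cell PercRepro2, typer-1 g10)

`K5K3Transfer.lean` transports the typed `K₃` base at `z ≡ false` (p2's `ResidualCore` form).  Here the
`ι : V ≃ Fin 5` pattern machinery of `K5TypedSimple.lean` transports it for EVERY minor `(F, z)`: on a
loop-free graph without parallel edges on five vertices, `K3_pattern` (the kernel of `G` is the kernel of
`K₅` along the pattern map) and `typedCount_pattern_eq` give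

* **`typedBases_five`**: `CovForm.TypedBases ends o a₁ a₂ a₃ b` — row 2′TRI itself, in the tree's vocabulary —
  for marks with `ι o = 0, ι a₁ = 1, ι a₂ = 2, ι a₃ = 3` and `ι b ∈ {4, 3, 0}` (distinct marks, `b = a₃`, or
  `o = b`);
* **`HCov_five`**: (HCOV) for every admissible weight vector on such a graph (`CovForm.HCov_of_typedBases`).
-/

namespace Summit.Ventures.PercRepro2

namespace K5

section Five

variable {V : Type*} {E : Type*} [Fintype E] [DecidableEq E] [DecidableEq V]
variable (ι : V ≃ Fin 5) (ends : E → Sym2 V)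
variable {R : Type*} [Field R]

omit [DecidableEq E] in
/-- **The kernel `K₃` of `G` is the kernel of `K₅` along the pattern map.** -/
lemma K3_pattern (o a₁ a₂ a₃ b : V) (x y w : Config E) :
    CovForm.K3 (R := R) ends o a₁ a₂ a₃ b x y w =
      CovForm.K3 (R := R) ends5 (ι o) (ι a₁) (ι a₂) (ι a₃) (ι b)
        (pattern ι ends x) (pattern ι ends y) (pattern ι ends w) := by
  unfold CovForm.K3 CovForm.sepKernel CovForm.f3 CovForm.f4 CovForm.f5 CovForm.f6 CovForm.f7 CovForm.f10
    CovForm.f11 CovForm.f12 CovForm.sigma CovForm.inU CovForm.iQ CovForm.iPD CovForm.iL CovForm.iH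
  simp only [Fin.sum_univ_succ, Fin.sum_univ_zero, Matrix.cons_val_zero, Matrix.cons_val_succ, add_zero,
    connEvent_eq_preimage ι ends, avoidAll_eq_preimage ι ends, PDEvent_eq_preimage ι ends, indicator_pattern]

/-- The typed counts of `K₃` on `G` are typed counts of `K₃` on `K₅`. -/
theorem typedCount_K3_eq_five (hloop : ∀ e, ¬ (ends e).IsDiag) (hinj : Function.Injective ends)
    (o a₁ a₂ a₃ b : V) (F : Finset E) (z : Config E) (τ : E → ℕ) :
    typedCount F z τ (CovForm.K3 (R := R) ends o a₁ a₂ a₃ b) =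
      typedCount (minorF ι ends F) (pattern ι ends z) (minorτ ι ends τ)
        (CovForm.K3 (R := R) ends5 (ι o) (ι a₁) (ι a₂) (ι a₃) (ι b)) := by
  rw [← typedCount_pattern_eq ι ends hloop hinj]
  congr 1
  funext x y w
  exact K3_pattern ι ends o a₁ a₂ a₃ b x y w

variable [LinearOrder R] [IsStrictOrderedRing R]

/-- **ROW 2′TRI ON EVERY LOOP-FREE GRAPH WITHOUT PARALLEL EDGES ON FIVE MARKED VERTICES**, all minors:
marks `ι o = 0, ι a₁ = 1, ι a₂ = 2, ι a₃ = 3` and `ι b ∈ {4, 3, 0}`. -/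
theorem typedBases_five (hloop : ∀ e, ¬ (ends e).IsDiag) (hinj : Function.Injective ends)
    (o a₁ a₂ a₃ b : V) (h₀ : ι o = 0) (h₁ : ι a₁ = 1) (h₂ : ι a₂ = 2) (h₃ : ι a₃ = 3)
    (hb : ι b = 4 ∨ ι b = 3 ∨ ι b = 0) :
    CovForm.TypedBases (R := R) ends o a₁ a₂ a₃ b := by
  intro F z τ _
  rw [typedCount_K3_eq_five ι ends hloop hinj, h₀, h₁, h₂, h₃]
  rcases hb with h | h | h <;> rw [h]
  · exact typedCount_K3_nonneg_of_cert 4 cert3_4 _ _ _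
  · exact typedCount_K3_nonneg_of_cert 3 cert3_3 _ _ _
  · exact typedCount_K3_nonneg_of_cert 0 cert3_0 _ _ _

/-- **(HCOV) on every such graph for every admissible weight vector.** -/
theorem HCov_five (hloop : ∀ e, ¬ (ends e).IsDiag) (hinj : Function.Injective ends)
    (o a₁ a₂ a₃ b : V) (h₀ : ι o = 0) (h₁ : ι a₁ = 1) (h₂ : ι a₂ = 2) (h₃ : ι a₃ = 3)
    (hb : ι b = 4 ∨ ι b = 3 ∨ ι b = 0) (p : E → R) (hp : IsProbVec p) :
    CovForm.HCov p ends o a₁ a₂ a₃ b :=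
  CovForm.HCov_of_typedBases ends o a₁ a₂ a₃ b (typedBases_five ι ends hloop hinj o a₁ a₂ a₃ b h₀ h₁ h₂ h₃ hb)
    p hp

end Five

end K5

end Summit.Ventures.PercRepro2
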